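import Summits.QuantumFields.YangMills.Theorems.UnitScaleTiltProp7TopMeanComparisonOnPropagator
import Summits.QuantumFields.YangMills.Theorems.UnitScaleTiltProp7MassivePropagatorTail
import HarnessLib

/-!
# Route `UnitScaleTilt`, crux K1 «MinimiserStabilityRegPr» (stmt-QuantumFields-19200), EX row `hGF[Lift]` (curved member) — **LOD LINE, PEN (L5″) (RB2) MEMBER DOCK:
# `‖S_W(G_1 h) − S_1(G_1 h)‖ ≤ c_Q‖h‖` IN ONE ROW** — routeR-w3 g12's 2b-door row `hRB2` (✓`Prop7ColumnPairingRows.sqrt_sum_normSq_inner_column_sub_le`) at the member, all letters px5's: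
the (RB2) knit ✓`Prop7TopMeanComparisonOnPropagator.norm_lift_topMean_sub_flat_le_of_tail` (p755451) fed by the tail number of ✓`Prop7MassivePropagatorTail.norm_tail_le_of_massive_eq`
(p756369) for the FLAT massive propagator `G_1` (abstract: `A_1(G_1 h) = h`, `A_1 w = Δ_1 w + a·T_1(ι(Q_1 w))`, `‖G_1 h‖ ≤ ν‖h‖`), the field letters `u = toL2S⁻¹(G_1 h)`, `f = toL2S⁻¹ h`
being internal: **`‖ι(Q_W(G_1 h)) − ι(Q_1(G_1 h))‖ ≤ (√(2κ)(9000L²ε₀ + 16mδ′)·ν + 2√(25κ∕8)·e^{−R}·8C_P²)·‖h‖`**.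

Cell `ym3-torus` (HUMAN RULING D-0037, YM ladder rung R3 — NOT d = 4, NOT infinite volume, NOT a mass gap, NOT Clay).  Width seat `ym3-torus-px5` gen 11; ★p1 g24 LOCATE-L6-ASSEMBLY
§1 Step I.2 (L5″), road (α); routeR-w3 g12 2026-08-30 00:44:48Z (RB2).  THEOREMS ONLY (0 `def`, 0 `sorry`); `--supports stmt-QuantumFields-19200 --as helper`, count-neutral.
HONEST LABEL (★★OWNER RULING №33 (6)): curved γ-row supplier line (LOD localisation), pen (L5″); displayed data: `RegPr F n K ε₀ 1` (✓`regPr_one_…`), walk-flatness of `W♭` on the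
blocks meeting `supp χ̃`, the Agmon phase∕plateau geometry and window, the abstract flat propagator identities; nothing of (3.49), Thm 3.1∕3.3, `h349`, `hGF`, EX ∕ 19200 is proved here.

References: T. Bałaban, CMP **99** (1985) 389–434 [Balaban1985BackgroundPropagators] ((3.16), (3.19) p.393, (3.21), (3.24) p.394, Thm 3.3 p.399, (3.105) p.414); CMP **98** (1985)
17–51 [Balaban1985Averaging] ((19)–(20) p.21, (97) p.32).
-/

set_option autoImplicit false

noncomputable section

open scoped BigOperators Matrix.Norms.L2Operator InnerProductSpace ComplexConjugate

namespace Summit.QuantumFields.YangMills.Theorems.Prop7TopMeanComparisonOnPropagatorDock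

open Literature.MathematicalPhysics.QuantumFieldTheory.Balaban1983to89
open T4Continuum BlockAveraging
open BlockAveraging (Idx)
open B7Prop1Explicit (U1 treeWord l1 disp)
open B5Eq118OneStroke (iterBlockOf iterBlock)
open B15DeterminingSets (embIter)
open B10Eq27TorusAxialLog (holT axialT rel transl)
open B7TransferAnalyticMean (meanCLM)
open B11Eq103H1Complex (SiteL2K)
open Summit.QuantumFields.YangMills.Theorems.Prop8Chart (emlIterU)
open Literature.MathematicalPhysics.QuantumFieldTheory.Balaban1983to89.T3ContinuumYM3Torus
open T3SectALandauChart (eta bgUnits)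
open T3PrintedRegularMinimiser (RegPr)
open T3PrintedRegularOrbits (sites_eq)
open T3LevelShift (siteShift)
open Summit.QuantumFields.YangMills.Theorems.Prop7SectET3Transport (periodsT3)
open Summit.QuantumFields.YangMills.Theorems.Prop7SectET3HilbertLetters (W₂ toL2S DL2 covLapSite)
open Summit.QuantumFields.YangMills.Theorems.Prop7TopMeanComparisonOnPropagator (norm_lift_topMean_sub_flat_le_of_tail)
open Summit.QuantumFields.YangMills.Theorems.Prop7MassivePropagatorTail (norm_tail_le_of_massive_eq)

variable (F : T3Family) {n K : ℕ} (h : n ≤ K) {c₀ c₁ : ℝ} [Fact (0 < c₀)] [Fact (0 < c₁)] {ε₀ : ℝ} (hε₀ : 0 < ε₀) (hε7 : 10 ^ 7 * (F.L : ℝ) ^ 3 * ε₀ ≤ 1)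
  (hreg1 : RegPr F n K ε₀ (1 : GaugeField (F.P K) 0 (Matrix.specialUnitaryGroup (Fin 2) ℂ)))
  (Q1 : SiteL2K ℂ 3 (periodsT3 F K) c₀ W₂ →ₗ[ℂ] (Site (F.P K) (K - n) → Matrix (Fin 2) (Fin 2) ℂ))
  (hseq1 : ∀ lam : Site (F.P K) 0 → Matrix (Fin 2) (Fin 2) ℂ, ∃ ns : (j : ℕ) → Site (F.P K) j → Matrix (Fin 2) (Fin 2) ℂ, ns 0 = lam ∧
        (∀ (j : ℕ) (y : Site (F.P K) (j + 1)), ns (j + 1) y = ns j (emb y) - meanCLM (Idx (F.P K)) (Matrix (Fin 2) (Fin 2) ℂ) fun i : Idx (F.P K) =>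
          ns j (emb y) - ((holT (emlIterU j (bgUnits F K (1 : GaugeField (F.P K) 0 (Matrix.specialUnitaryGroup (Fin 2) ℂ)))) (emb y) (stairWord i.2.1 (off i.1)) : (Matrix (Fin 2) (Fin 2) ℂ)ˣ) : Matrix (Fin 2) (Fin 2) ℂ) *
            ns j (transl (emb y) (disp (stairWord i.2.1 (off i.1)))) * (((holT (emlIterU j (bgUnits F K (1 : GaugeField (F.P K) 0 (Matrix.specialUnitaryGroup (Fin 2) ℂ)))) (emb y) (stairWord i.2.1 (off i.1)))⁻¹ : (Matrix (Fin 2) (Fin 2) ℂ)ˣ) : Matrix (Fin 2) (Fin 2) ℂ)) ∧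
        ns (K - n) = Q1 (toL2S F K c₀ lam))
  (ι : (Site (F.P K) (K - n) → Matrix (Fin 2) (Fin 2) ℂ) →ₗ[ℂ] SiteL2K ℂ 3 (periodsT3 F n) c₁ W₂)
  (hι : ∀ c, ι c = toL2S F n c₁ (fun z => c (siteShift (sites_eq F n K h) z)))
  (T1 : SiteL2K ℂ 3 (periodsT3 F n) c₁ W₂ →ₗ[ℂ] SiteL2K ℂ 3 (periodsT3 F K) c₀ W₂)
  (hT1 : ∀ (l : SiteL2K ℂ 3 (periodsT3 F K) c₀ W₂) (f : SiteL2K ℂ 3 (periodsT3 F n) c₁ W₂), ⟪ι (Q1 l), f⟫_ℂ = ⟪l, T1 f⟫_ℂ)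
  (U : GaugeField (F.P K) 0 (Matrix.specialUnitaryGroup (Fin 2) ℂ)) (hregU : RegPr F n K ε₀ U)
  (QU : SiteL2K ℂ 3 (periodsT3 F K) c₀ W₂ →ₗ[ℂ] (Site (F.P K) (K - n) → Matrix (Fin 2) (Fin 2) ℂ))
  (hseqU : ∀ lam : Site (F.P K) 0 → Matrix (Fin 2) (Fin 2) ℂ, ∃ ns : (j : ℕ) → Site (F.P K) j → Matrix (Fin 2) (Fin 2) ℂ, ns 0 = lam ∧
        (∀ (j : ℕ) (y : Site (F.P K) (j + 1)), ns (j + 1) y = ns j (emb y) - meanCLM (Idx (F.P K)) (Matrix (Fin 2) (Fin 2) ℂ) fun i : Idx (F.P K) =>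
          ns j (emb y) - ((holT (emlIterU j (bgUnits F K U)) (emb y) (stairWord i.2.1 (off i.1)) : (Matrix (Fin 2) (Fin 2) ℂ)ˣ) : Matrix (Fin 2) (Fin 2) ℂ) *
            ns j (transl (emb y) (disp (stairWord i.2.1 (off i.1)))) * (((holT (emlIterU j (bgUnits F K U)) (emb y) (stairWord i.2.1 (off i.1)))⁻¹ : (Matrix (Fin 2) (Fin 2) ℂ)ˣ) : Matrix (Fin 2) (Fin 2) ℂ)) ∧
        ns (K - n) = QU (toL2S F K c₀ lam))
  {a : ℝ} (ha : 0 < a)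

include h hε₀ hε7 hreg1 hseq1 hι hT1 hregU hseqU ha in
/-- ★★★ **(RB2) AT THE MEMBER, ONE ROW**: flat system of record `(Q_1, T_1)` at `U₀ = 1`, curved `Q_U` at `U` with `U♭` `δ′`-flat on the two comb walks of every `x` in a block meeting
`supp χ̃` (`l1 ≤ m`, `1 ≤ m`, `4mδ′ ≤ 1`); the FLAT massive propagator as an abstract map `G_1` with `A_1(G_1 h) = h` for `A_1 w = Δ_1 w + a·T_1(ι(Q_1 w))` and `‖G_1 h‖ ≤ ν‖h‖`;
an Agmon phase `φ` (bond steps `θ`, block oscillation `θ′` about `φc`, window `3η⁻²(e^θ−1)² + a(25κ∕8)(e^{θ′}−1)² ≤ δ₁²`, `C_P δ₁ ≤ 1∕10`) vanishing on `supp h` and `≥ R` off the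
plateau `{χ̃ = 1}` (`|χ̃| ≤ 1`, `|1 − χ̃| ≤ 1`): **`‖ι(Q_U(G_1 h)) − ι(Q_1(G_1 h))‖ ≤ (√(2κ)·(9000L²ε₀ + 16mδ′)·ν + 2·√(25κ∕8)·(e^{−R}·8C_P²))·‖h‖`** — 2b-door's `hRB2` with this `c_Q`.
[cite: Balaban1985BackgroundPropagators, (3.16), (3.19) p.393, (3.21), (3.24) p.394, Thm 3.3 p.399, (3.105) p.414; Balaban1985Averaging, (19)-(20) p.21, (97) p.32] -/
theorem norm_lift_topMean_sub_flat_propagated_le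
    (χt : Site (F.P K) 0 → ℝ) (hχ1 : ∀ x, |χt x| ≤ 1) (hχt : ∀ x, |1 - χt x| ≤ 1)
    {δ' : ℝ} (hδ' : 0 ≤ δ') {m : ℕ} (hm1 : 1 ≤ m) (hmδ : 4 * (m : ℝ) * δ' ≤ 1)
    (hlen : ∀ Y : Site (F.P K) (K - n), (∃ x ∈ iterBlock (K - n) Y, χt x ≠ 0) → ∀ x ∈ iterBlock (K - n) Y,
      l1 (rel (Site.fibreSite 0 (K - n) (iterBlockOf (K - n) x) fun _ => (⟨0, pow_pos (F.P K).L_pos (K - n)⟩ : Fin ((F.P K).L ^ (K - n)))) (embIter (K - n) Y)) ≤ m ∧ l1 (rel (Site.fibreSite 0 (K - n) (iterBlockOf (K - n) x) fun _ => (⟨0, pow_pos (F.P K).L_pos (K - n)⟩ : Fin ((F.P K).L ^ (K - n)))) x) ≤ m)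
    (hw : ∀ Y : Site (F.P K) (K - n), (∃ x ∈ iterBlock (K - n) Y, χt x ≠ 0) → ∀ x ∈ iterBlock (K - n) Y,
      (∀ st ∈ walk (Site.fibreSite 0 (K - n) (iterBlockOf (K - n) x) fun _ => (⟨0, pow_pos (F.P K).L_pos (K - n)⟩ : Fin ((F.P K).L ^ (K - n)))) (treeWord (rel (Site.fibreSite 0 (K - n) (iterBlockOf (K - n) x) fun _ => (⟨0, pow_pos (F.P K).L_pos (K - n)⟩ : Fin ((F.P K).L ^ (K - n)))) (embIter (K - n) Y))), ‖((bgUnits F K U st.bond : (Matrix (Fin 2) (Fin 2) ℂ)ˣ) : Matrix (Fin 2) (Fin 2) ℂ) - 1‖ ≤ δ') ∧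
      (∀ st ∈ walk (Site.fibreSite 0 (K - n) (iterBlockOf (K - n) x) fun _ => (⟨0, pow_pos (F.P K).L_pos (K - n)⟩ : Fin ((F.P K).L ^ (K - n)))) (treeWord (rel (Site.fibreSite 0 (K - n) (iterBlockOf (K - n) x) fun _ => (⟨0, pow_pos (F.P K).L_pos (K - n)⟩ : Fin ((F.P K).L ^ (K - n)))) x)), ‖((bgUnits F K U st.bond : (Matrix (Fin 2) (Fin 2) ℂ)ˣ) : Matrix (Fin 2) (Fin 2) ℂ) - 1‖ ≤ δ'))
    (φ : Site (F.P K) 0 → ℝ) (φc : Site (F.P K) (K - n) → ℝ) {θ θ' : ℝ} (hθ' : 0 ≤ θ')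
    (hφ : ∀ b : PBond (F.P K) 0, |φ b.tgt - φ b.src| ≤ θ) (hφc : ∀ x : Site (F.P K) 0, |φ x - φc (iterBlockOf (K - n) x)| ≤ θ')
    {δ₁ : ℝ} (hδ₁ : 0 ≤ δ₁)
    (hδ : 3 * ((eta F n K)⁻¹) ^ 2 * (Real.exp θ - 1) ^ 2 + a * ((25 / 8) * (c₁ * ((((F.P K).L : ℝ) ^ (F.P K).d) ^ (K - n))⁻¹ / c₀)) * (Real.exp θ' - 1) ^ 2 ≤ δ₁ ^ 2)
    (hwin : Real.sqrt (max 2 (16 * c₀ * ((F.L : ℝ) ^ (K - n)) ^ 3 / (a * c₁))) * δ₁ ≤ 1 / 10)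
    {R : ℝ} (hR : ∀ x, χt x ≠ 1 → R ≤ φ x)
    (A1 G1 : SiteL2K ℂ 3 (periodsT3 F K) c₀ W₂ →ₗ[ℂ] SiteL2K ℂ 3 (periodsT3 F K) c₀ W₂) (hA1 : ∀ w, A1 w = covLapSite F n K c₀ (1 : GaugeField (F.P K) 0 (Matrix.specialUnitaryGroup (Fin 2) ℂ)) w + (a : ℂ) • T1 (ι (Q1 w)))
    {ν : ℝ} (hh : SiteL2K ℂ 3 (periodsT3 F K) c₀ W₂) (hAG : A1 (G1 hh) = hh) (hG1 : ‖G1 hh‖ ≤ ν * ‖hh‖)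
    (hφh : ∀ x, (toL2S F K c₀).symm hh x ≠ 0 → φ x = 0) :
    ‖ι (QU (G1 hh)) - ι (Q1 (G1 hh))‖
      ≤ (Real.sqrt (2 * (c₁ * ((((F.P K).L : ℝ) ^ (F.P K).d) ^ (K - n))⁻¹ / c₀)) * (2 * (4500 * (F.L : ℝ) ^ 2 * ε₀) + 16 * m * δ') * ν
          + 2 * Real.sqrt ((25 / 8) * (c₁ * ((((F.P K).L : ℝ) ^ (F.P K).d) ^ (K - n))⁻¹ / c₀)) * (Real.exp (-R) * (8 * Real.sqrt (max 2 (16 * c₀ * ((F.L : ℝ) ^ (K - n)) ^ 3 / (a * c₁))) ^ 2))) * ‖hh‖ := by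
  have hc₀ : 0 < c₀ := Fact.out
  have hc₁ : 0 < c₁ := Fact.out
  set u : Site (F.P K) 0 → Matrix (Fin 2) (Fin 2) ℂ := (toL2S F K c₀).symm (G1 hh) with hu
  set f : Site (F.P K) 0 → Matrix (Fin 2) (Fin 2) ℂ := (toL2S F K c₀).symm hh with hf
  have hu' : toL2S F K c₀ u = G1 hh := LinearEquiv.apply_symm_apply _ _
  have hf' : toL2S F K c₀ f = hh := LinearEquiv.apply_symm_apply _ _
  -- the massive equation in field form
  have hAu : covLapSite F n K c₀ (1 : GaugeField (F.P K) 0 (Matrix.specialUnitaryGroup (Fin 2) ℂ)) (toL2S F K c₀ u) + (a : ℂ) • T1 (ι (Q1 (toL2S F K c₀ u))) = toL2S F K c₀ f := by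
    rw [hu', hf', ← hA1, hAG]
  -- the tail number
  have htail := norm_tail_le_of_massive_eq F h hε₀ hε7 (1 : GaugeField (F.P K) 0 (Matrix.specialUnitaryGroup (Fin 2) ℂ)) hreg1 Q1 hseq1 ι hι T1 hT1 ha φ φc hθ' hφ hφc hδ₁ hδ hwin χt hχt hR u f hφh hAu
  -- the (RB2) knit
  have key := norm_lift_topMean_sub_flat_le_of_tail F hε₀ hε7 U hregU QU hseqU h ι hι hreg1 Q1 hseq1 χt hχ1 hδ' hm1 hmδ hlen hw u htail
  rw [hu', hf'] at key
  have hL := (F.P K).L_pos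
  have hA0 : 0 ≤ Real.sqrt (2 * (c₁ * ((((F.P K).L : ℝ) ^ (F.P K).d) ^ (K - n))⁻¹ / c₀)) * (2 * (4500 * (F.L : ℝ) ^ 2 * ε₀) + 16 * m * δ') := by positivity
  have hB0 : 0 ≤ 2 * Real.sqrt ((25 / 8) * (c₁ * ((((F.P K).L : ℝ) ^ (F.P K).d) ^ (K - n))⁻¹ / c₀)) * (Real.exp (-R) * (8 * Real.sqrt (max 2 (16 * c₀ * ((F.L : ℝ) ^ (K - n)) ^ 3 / (a * c₁))) ^ 2)) := by positivity
  calc _ ≤ Real.sqrt (2 * (c₁ * ((((F.P K).L : ℝ) ^ (F.P K).d) ^ (K - n))⁻¹ / c₀)) * (2 * (4500 * (F.L : ℝ) ^ 2 * ε₀) + 16 * m * δ') * ‖G1 hh‖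
        + 2 * Real.sqrt ((25 / 8) * (c₁ * ((((F.P K).L : ℝ) ^ (F.P K).d) ^ (K - n))⁻¹ / c₀)) * (Real.exp (-R) * (8 * Real.sqrt (max 2 (16 * c₀ * ((F.L : ℝ) ^ (K - n)) ^ 3 / (a * c₁))) ^ 2) * ‖hh‖) := key
    _ ≤ Real.sqrt (2 * (c₁ * ((((F.P K).L : ℝ) ^ (F.P K).d) ^ (K - n))⁻¹ / c₀)) * (2 * (4500 * (F.L : ℝ) ^ 2 * ε₀) + 16 * m * δ') * (ν * ‖hh‖)
        + 2 * Real.sqrt ((25 / 8) * (c₁ * ((((F.P K).L : ℝ) ^ (F.P K).d) ^ (K - n))⁻¹ / c₀)) * (Real.exp (-R) * (8 * Real.sqrt (max 2 (16 * c₀ * ((F.L : ℝ) ^ (K - n)) ^ 3 / (a * c₁))) ^ 2) * ‖hh‖) :=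
        add_le_add (mul_le_mul_of_nonneg_left hG1 hA0) le_rfl
    _ = _ := by ring

end Summit.QuantumFields.YangMills.Theorems.Prop7TopMeanComparisonOnPropagatorDock
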